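import Literature.Barriers.FinalStateConjecture.ExtremalHorizonAxisymmetricDecayProofs
import Literature.Barriers.FinalStateConjecture.ExtremalHorizonInstabilityNarrowLeaves
import Literature.Geometry.Lorentzian.KerrSchildWaveCauchyProblemProofs
import HarnessLib

/-!
# Discharges of named facts of `ExtremalHorizonInstability.lean`

`Literature/Barriers/FinalStateConjecture/ExtremalHorizonInstabilityHolds.lean` — proofs-only
sibling of `ExtremalHorizonInstability.lean` (no definitions, no named facts). Each theorem
below closes a named fact `X : Prop` of that file as `X_holds : X` by composing an ACCEPTED
reduction theorem of the tree with the ACCEPTED unconditional `_holds` discharges of all of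
its hypotheses; nothing is re-proved and no statement is changed. Recorded by the librarian
sweep g25 (2026-08-16, pass 5c: facts dischargeable in one line from the tree's own lemmas),
so that the facts census, `#h21_route_deps` and the cone guardrail see these facts as
theorems.

Discharged here:

* `AretakisInstability_holds` := `of_twoLeaves` `waveCauchyProblem_holds`
  `Aretakis2012_pointwiseDecay_holds` (`ExtremalHorizonInstabilityNarrowLeaves.lean`).

## References

* [AngelopoulosKehleUnger2024] — see `lean/references.bib` and the docstring of the fact in `ExtremalHorizonInstability.lean`.
* [Apetroaie2022] — see `lean/references.bib` and the docstring of the fact in `ExtremalHorizonInstability.lean`.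
* [Aretakis2012] — see `lean/references.bib` and the docstring of the fact in `ExtremalHorizonInstability.lean`.
* [Aretakis2015] — see `lean/references.bib` and the docstring of the fact in `ExtremalHorizonInstability.lean`.
* [Dafermos2025] — see `lean/references.bib` and the docstring of the fact in `ExtremalHorizonInstability.lean`.
* [DafermosRodnianskiShlapentokhrothman2014] — see `lean/references.bib` and the docstring of the fact in `ExtremalHorizonInstability.lean`.
* [Gajic2023] — see `lean/references.bib` and the docstring of the fact in `ExtremalHorizonInstability.lean`.
* [KehleUnger2025] — see `lean/references.bib` and the docstring of the fact in `ExtremalHorizonInstability.lean`.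
* [LuciettiReall2012] — see `lean/references.bib` and the docstring of the fact in `ExtremalHorizonInstability.lean`.
* [Sbierski2015] — see `lean/references.bib` and the docstring of the fact in `ExtremalHorizonInstability.lean`.
-/

namespace Literature.Barriers.FinalStateConjecture

/-- **Discharge of the named fact `AretakisInstability`** (`ExtremalHorizonInstability.lean`):
Barrier (Aretakis instability): on extremal Kerr, `a = M`, transversal derivatives of generic
solutions of the wave equation do not decay along the future event horizon and second
transversal derivatives blow up linearly in time. Aretakis, ATMP 19 (2015), … — obtained as
`of_twoLeaves` applied to the tree's unconditional discharges `waveCauchyProblem_holds`,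
`Aretakis2012_pointwiseDecay_holds` of its hypotheses (reduction in
`ExtremalHorizonInstabilityNarrowLeaves.lean`).
[cite: Aretakis2015, Thm. 3]
[cite: LuciettiReall2012]
[cite: Dafermos2025, §5.1]
[cite: DafermosRodnianskiShlapentokhrothman2014, §1 (p. 4)]
[cite: Sbierski2015, §1 item 2 (p. 2)]
[cite: Dafermos2025, §5.4]
[cite: Aretakis2015, Thms. 1–2 (p. 10) and Prop. 5.1 (p. 12)]
[cite: Aretakis2015, Thm. 3 (p. 12)]
[cite: DafermosRodnianskiShlapentokhrothman2014, §1.1.4 (p. 7)]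
[cite: Dafermos2025, §5.2]
[cite: Aretakis2012]
[cite: Aretakis2015, §5.2 (p. 12)]
[cite: Dafermos2025, §5.3]
[cite: Dafermos2025, §6.1]
[cite: KehleUnger2025]
[cite: Dafermos2025, Thm. 3.1 (§3.1)]
[cite: Dafermos2025, §6.1 and §6.4]
[cite: DafermosRodnianskiShlapentokhrothman2014, §1 (p. 4) and §1.1.4 (p. 7)]
[cite: DafermosRodnianskiShlapentokhrothman2014, Cor. 3.1 (31)]
[cite: AngelopoulosKehleUnger2024, Thm. 2]
[cite: Apetroaie2022, Thm. (rough version) ii(b) (p. 4)]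
[cite: LuciettiReall2012, §2.2]
[cite: AngelopoulosKehleUnger2024, Thm. 1]
[cite: Gajic2023, Rem. 1.4 (p. 4)]
[cite: Dafermos2025, Conj. 6.1, Conj. 6.2 and §6.4] -/
theorem AretakisInstability_holds :
    AretakisInstability :=
  Literature.Barriers.FinalStateConjecture.AretakisInstability.of_twoLeaves
    Literature.Geometry.Lorentzian.KerrSchild.waveCauchyProblem_holds
    Aretakis2012_pointwiseDecay_holds

end Literature.Barriers.FinalStateConjecture
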